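import Summits.HodgeConjecture.HodgeConjecture.Theorems.LinearSystemTorelliLocalTubeSpanFrameLiftBasic
import Summits.HodgeConjecture.HodgeConjecture.Theorems.LinearSystemTorelliLocalTubeSpanPlaneCalculus
import Mathlib.Tactic.Module

/-!
# Route LinearSystemTorelli — crux `LocalTubeSpan` (stmt-HodgeConjecture-2490): squares of transvections along differences of orthogonal partners are monodromy

Helper file (`--supports stmt-HodgeConjecture-2490`, line `Sketch` of the crux chain, cycle 8,
continuation lead c7; the lead's stub `stub_orthogonalPartnersSquare`, worker P): the `β = 0` case
of the "`β`-pair lemma" of the cycle's attack on Janssen's Theorem 2.5 — transvections along certain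
NON-`Δ` vectors have monodromy squares.

For an alternating form `B` on a `ℚ`-vector space `V` (`T_a x = x - B(x, a) a`, `skewTransvection`,
`T_a⁻¹ x = x + B(x, a) a`) and a skew vanishing lattice `Δ` with monodromy group
`Γ_Δ = transvectionGroup B Δ`:

* `localTubeSpan_skewTransvection_neg` — `T_{-a} = T_a`;
* `localTubeSpan_fourLetter_apply` — the FOUR-LETTER IDENTITY: for `B(w, n) = 0`,
  `T_{w+n} (T_w⁻¹ (T_{w-n} (T_w⁻¹ v))) = v - 2 B(v, n) n`, i.e. `T_{w+n} T_w⁻¹ T_{w-n} T_w⁻¹ = T_n²`;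
* `localTubeSpan_exists_unit_eq_skewTransvection` — the unit of `GL(V)` underlying `T_a`, `a ∈ Δ`,
  lies in `Γ_Δ`;
* `localTubeSpan_orthogonalPartners_add_mem` — for `u, δ ∈ Δ` with `B(u, δ) = 1`, `u + δ = T_u δ ∈ Δ`;
* `localTubeSpan_orthogonalPartners_sub_two_smul_mem` — for `u, δ, δ' ∈ Δ` with
  `B(u, δ) = B(u, δ') = 1`, `B(δ, δ') = 0`: `δ' - 2δ ∈ Δ` (it is the image of `δ'` under the word
  `T_u² T_δ² T_{u+δ}²`, the "`-1` of the plane `(u, δ)`", `localTubeSpan_negOnPlane`);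
* `localTubeSpan_orthogonalPartnersSquare` — the registered stub: under the same hypotheses some
  element of `Γ_Δ` acts as `T_{δ'-δ}²`, `v ↦ v - 2 B(v, δ' - δ) (δ' - δ)`; it is the word
  `T_{δ'} T_δ⁻¹ T_{δ'-2δ} T_δ⁻¹` (the four-letter identity with `w = δ`, `n = δ' - δ`, and
  `T_{2δ-δ'} = T_{δ'-2δ}`).

No named facts; no `sorry`.
-/

-- `Summit.HodgeConjecture.HodgeConjecture.Theorems` is the mandated namespace (single-conjunct summit:
-- Sub = Summit), which `linter.dupNamespace` flags on every declaration; the lakefile turns the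
-- linter off tree-wide (weak option), restated here so stand-alone elaboration is warning-free too.
set_option linter.dupNamespace false

noncomputable section

open Literature.AlgebraicGeometry.HodgeTheory

namespace Summit.HodgeConjecture.HodgeConjecture.Theorems

/-! ### The four-letter identity and squares along differences of orthogonal partners -/

section OrthogonalPartnersSquare

variable {V : Type} [AddCommGroup V] [Module ℚ V]

/-- `T_{-a} = T_a`: a transvection only depends on its vector up to sign
(`B(x, -a) (-a) = B(x, a) a`). [folklore] -/
theorem localTubeSpan_skewTransvection_neg (B : LinearMap.BilinForm ℚ V) (a : V) :
    skewTransvection B (-a) = skewTransvection B a := by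
  ext x
  rw [skewTransvection_apply, skewTransvection_apply, map_neg, neg_smul, smul_neg, neg_neg]

/-- **The four-letter identity.** For an alternating form `B` and `B(w, n) = 0`,
`T_{w+n} (T_w⁻¹ (T_{w-n} (T_w⁻¹ v))) = v - 2 B(v, n) n`, where `T_w⁻¹ x = x + B(x, w) w`; that is,
`T_{w+n} T_w⁻¹ T_{w-n} T_w⁻¹ = T_n²`.  (With `a = B(v, w)`, `b = B(v, n)`: `T_w⁻¹ v = v + a w`,
then `T_{w-n}` gives `v + b w + (a - b) n`, then `T_w⁻¹` gives `v + (a + b) w + (a - b) n`, and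
`T_{w+n}` subtracts `(a + b)(w + n)`.) [folklore] -/
theorem localTubeSpan_fourLetter_apply (B : LinearMap.BilinForm ℚ V) (hB : B.IsAlt) {w n : V}
    (hwn : B w n = 0) (v : V) :
    skewTransvection B (w + n)
        (skewTransvection B (w - n) (v + B v w • w) +
          B (skewTransvection B (w - n) (v + B v w • w)) w • w) =
      v - (2 : ℚ) • (B v n • n) := by
  have hww : B w w = 0 := hB.self_eq_zero w
  have hnn : B n n = 0 := hB.self_eq_zero n
  have hnw : B n w = 0 := by rw [← hB.neg_eq, hwn, neg_zero]
  simp only [skewTransvection_apply, map_add, map_sub, map_smul, LinearMap.add_apply,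
    LinearMap.sub_apply, LinearMap.smul_apply, smul_eq_mul, hww, hnn, hwn, hnw]
  module

/-- For `a ∈ Δ` the unit of `GL(V)` underlying `T_a` (alternating `B`) lies in `Γ_Δ` and has
underlying linear map `T_a`. [folklore] -/
theorem localTubeSpan_exists_unit_eq_skewTransvection (B : LinearMap.BilinForm ℚ V) (hB : B.IsAlt)
    (Δ : Set V) {a : V} (ha : a ∈ Δ) :
    ∃ t ∈ transvectionGroup B Δ, ((t : (V →ₗ[ℚ] V)ˣ) : V →ₗ[ℚ] V) = skewTransvection B a :=
  ⟨LinearMap.GeneralLinearGroup.ofLinearEquiv (skewTransvectionEquiv B (hB.self_eq_zero a)),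
    unit_skewTransvection_mem_transvectionGroup B ha (hB.self_eq_zero a), rfl⟩

/-- For `u, δ` in a skew vanishing lattice `Δ` with `B(u, δ) = 1`, `u + δ ∈ Δ`: indeed
`T_u δ = δ - B(δ, u) u = δ + u` and `Δ` is `Γ_Δ`-stable. [folklore] -/
theorem localTubeSpan_orthogonalPartners_add_mem (B : LinearMap.BilinForm ℚ V) (hB : B.IsAlt)
    (Δ : Set V) (hΔ : IsSkewVanishingLattice B Δ) {u δ : V} (hu : u ∈ Δ) (hδ : δ ∈ Δ)
    (huδ : B u δ = 1) : u + δ ∈ Δ := by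
  obtain ⟨tu, htu, htu_eq⟩ := localTubeSpan_exists_unit_eq_skewTransvection B hB Δ hu
  have h := hΔ.stable tu htu δ hδ
  rwa [htu_eq, skewTransvection_apply, ← hB.neg_eq, huδ, neg_smul, one_smul, sub_neg_eq_add,
    add_comm] at h

/-- For `u, δ, δ'` in a skew vanishing lattice `Δ` with `B(u, δ) = B(u, δ') = 1` and `B(δ, δ') = 0`,
`δ' - 2δ ∈ Δ`: the word `T_u² T_δ² T_{u+δ}² ∈ Γ_Δ` (`u + δ ∈ Δ`) acts as the "`-1` of the plane
`(u, δ)`", `v ↦ v - 2 (B(v, δ) u - B(v, u) δ)`, and sends `δ'` (`B(δ', δ) = 0`, `B(δ', u) = -1`) to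
`δ' - 2δ`. [folklore] -/
theorem localTubeSpan_orthogonalPartners_sub_two_smul_mem (B : LinearMap.BilinForm ℚ V)
    (hB : B.IsAlt) (Δ : Set V) (hΔ : IsSkewVanishingLattice B Δ) {u δ δ' : V} (hu : u ∈ Δ)
    (hδ : δ ∈ Δ) (hδ' : δ' ∈ Δ) (huδ : B u δ = 1) (huδ' : B u δ' = 1) (hδδ' : B δ δ' = 0) :
    δ' - (2 : ℚ) • δ ∈ Δ := by
  obtain ⟨tu, htu, htu_eq⟩ := localTubeSpan_exists_unit_eq_skewTransvection B hB Δ hu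
  obtain ⟨td, htd, htd_eq⟩ := localTubeSpan_exists_unit_eq_skewTransvection B hB Δ hδ
  obtain ⟨ts, hts, hts_eq⟩ := localTubeSpan_exists_unit_eq_skewTransvection B hB Δ
    (localTubeSpan_orthogonalPartners_add_mem B hB Δ hΔ hu hδ huδ)
  have hδ'δ : B δ' δ = 0 := by rw [← hB.neg_eq, hδδ', neg_zero]
  have hδ'u : B δ' u = -1 := by rw [← hB.neg_eq, huδ']
  have h := hΔ.stable (tu * tu * (td * td) * (ts * ts))
    (mul_mem (mul_mem (mul_mem htu htu) (mul_mem htd htd)) (mul_mem hts hts)) δ' hδ'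
  have e : δ' - (2 : ℚ) • (B δ' δ • u - B δ' u • δ) = δ' - (2 : ℚ) • δ := by
    rw [hδ'δ, hδ'u]
    module
  simp only [Units.val_mul, Module.End.mul_apply] at h
  rwa [htu_eq, htd_eq, hts_eq, localTubeSpan_negOnPlane B hB huδ, e] at h

/-- **Squares of transvections along differences of orthogonal partners are monodromy.**  For a
skew vanishing lattice `Δ` of an alternating form `B` and `u, δ, δ' ∈ Δ` with
`B(u, δ) = B(u, δ') = 1` and `B(δ, δ') = 0`, some element of `Γ_Δ` acts as `T_{δ'-δ}²`,
`v ↦ v - 2 B(v, δ' - δ) (δ' - δ)` — namely the word `T_{δ'} T_δ⁻¹ T_{δ'-2δ} T_δ⁻¹`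
(`δ' - 2δ ∈ Δ`, `localTubeSpan_orthogonalPartners_sub_two_smul_mem`; the four-letter identity
`localTubeSpan_fourLetter_apply` with `w = δ`, `n = δ' - δ`, `w + n = δ'`,
`T_{w-n} = T_{2δ-δ'} = T_{δ'-2δ}`).  The `β = 0` case of the `β`-pair lemma. [folklore] -/
theorem localTubeSpan_orthogonalPartnersSquare (B : LinearMap.BilinForm ℚ V) (hB : B.IsAlt)
    (Δ : Set V) (hΔ : IsSkewVanishingLattice B Δ) {u δ δ' : V} (hu : u ∈ Δ) (hδ : δ ∈ Δ)
    (hδ' : δ' ∈ Δ) (huδ : B u δ = 1) (huδ' : B u δ' = 1) (hδδ' : B δ δ' = 0) :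
    ∃ g ∈ transvectionGroup B Δ, ∀ v : V,
      ((g : (V →ₗ[ℚ] V)ˣ) : V →ₗ[ℚ] V) v = v - (2 : ℚ) • (B v (δ' - δ) • (δ' - δ)) := by
  obtain ⟨td, htd, htd_eq⟩ := localTubeSpan_exists_unit_eq_skewTransvection B hB Δ hδ
  obtain ⟨td', htd', htd'_eq⟩ := localTubeSpan_exists_unit_eq_skewTransvection B hB Δ hδ'
  obtain ⟨t₂, ht₂, ht₂_eq⟩ := localTubeSpan_exists_unit_eq_skewTransvection B hB Δ
    (localTubeSpan_orthogonalPartners_sub_two_smul_mem B hB Δ hΔ hu hδ hδ' huδ huδ' hδδ')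
  have hδδ : B δ δ = 0 := hB.self_eq_zero δ
  have hwn : B δ (δ' - δ) = 0 := by rw [map_sub, hδδ', hδδ, sub_zero]
  have e1 : δ + (δ' - δ) = δ' := by abel
  have e2 : δ - (δ' - δ) = -(δ' - (2 : ℚ) • δ) := by module
  refine ⟨td' * td⁻¹ * t₂ * td⁻¹,
    mul_mem (mul_mem (mul_mem htd' (inv_mem htd)) ht₂) (inv_mem htd), fun v => ?_⟩
  -- the four-letter identity with `w = δ`, `n = δ' - δ`
  have key := localTubeSpan_fourLetter_apply B hB hwn v
  rw [e1, e2, localTubeSpan_skewTransvection_neg] at key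
  rw [Units.val_mul, Units.val_mul, Units.val_mul, Module.End.mul_apply, Module.End.mul_apply,
    Module.End.mul_apply, localTubeSpan_unit_inv_apply B htd_eq hδδ v, ht₂_eq,
    localTubeSpan_unit_inv_apply B htd_eq hδδ, htd'_eq]
  exact key

end OrthogonalPartnersSquare

end Summit.HodgeConjecture.HodgeConjecture.Theorems

end
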